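import Literature.Barriers.CriticalPhenomena.TimarLevelComponentsQuasiTransitive
import Literature.Barriers.CriticalPhenomena.TimarNoLightClustersQuasiTransitive
import Literature.Barriers.CriticalPhenomena.TimarFiniteLevelUnionCutQuasiTransitive
import HarnessLib

/-!
# Hutchcroft 2016: critical percolation on quasi-transitive graphs of exponential growth has no
# infinite clusters — the named fact `Hutchcroft2016_noPercolationAtCriticality` DISCHARGED

(Proofs for `SubexponentialGrowthZd.lean`, third proof file: `SubexponentialGrowthZdProofs.lean` and
`SubexponentialGrowthZdDischarge.lean` are upstream of the Timár bricks imported here, so the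
discharge cannot be appended to either without closing an import cycle.)

Barrier catalogue `Literature/Barriers/CriticalPhenomena/`; the proof file of the named fact
`Hutchcroft2016_noPercolationAtCriticality` of `SubexponentialGrowthZd.lean`:

> **Theorem (Hutchcroft 2016, Thm. 1.1).** Let `G` be a connected, locally finite,
> quasi-transitive graph of exponential growth. Then `θ(p_c) = 0`: Bernoulli(`p_c`) bond
> percolation on `G` has no infinite cluster almost surely.

T. Hutchcroft, *Critical percolation on any quasi-transitive graph of exponential growth has no
infinite clusters*, C. R. Math. Acad. Sci. Paris 354 (2016) 944–947. The printed proof (§2)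
splits according to unimodularity: in the unimodular case the growth-vs-two-arm argument of the
paper; in the nonunimodular case "the result follows from Timár's theorem [Timár 2006, Thm. 5.1
with Thm. 4.1/Cor. 5.6] … (the proof goes through for quasi-transitive graphs)". The tree proves
the unimodular case and the whole reduction
(`Hutchcroft2016_noPercolationAtCriticality_of_quasiTransitive_theorems`,
`TimarLevelComponentsQuasiTransitive.lean`) from the two theorems of Timár IN THE QUASI-TRANSITIVE
SETTING, which are proved in the sibling files:

* Timár 2006, Thm. 4.3 (no infinite light clusters at `p_c`), quasi-transitive:
  `Timar2006_noInfiniteLightClusters_quasiTransitive` (`TimarNoLightClustersQuasiTransitive.lean`,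
  on a height system, `TimarHeightsQuasiTransitive.lean`);
* Timár 2006, Thm. 5.5 (a heavy cluster has an infinite component inside a finite union of
  levels), quasi-transitive: `Timar2006_finiteLevelUnion_quasiTransitive`
  (`TimarFiniteLevelUnionCutQuasiTransitive.lean`, the cut route with the extreme edge ratio `δ`,
  bounded climbs/descents and the MTP summed over orbit representatives).

## References

* T. Hutchcroft, C. R. Math. Acad. Sci. Paris 354 (2016) 944–947 (arXiv:1605.05301), Thm. 1.1
  and §2. [Hutchcroft2016]
* Á. Timár, Ann. Probab. 34 (2006) 2344–2364 (arXiv:math/0702875), Thms. 4.3, 5.1, 5.5,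
  Cor. 5.6. [Timar2006]
* I. Benjamini, R. Lyons, Y. Peres, O. Schramm, Ann. Probab. 27 (1999) 1347–1356 (critical
  percolation on nonamenable/unimodular graphs). [BLPS1999b]
-/

noncomputable section

namespace Literature.Barriers.CriticalPhenomena

/-- **Hutchcroft 2016, Thm. 1.1, PROVED** — the named fact
`Hutchcroft2016_noPercolationAtCriticality` (`SubexponentialGrowthZd.lean`) holds: critical
Bernoulli bond percolation on a connected, locally finite, quasi-transitive graph of exponential
growth has almost surely no infinite cluster. Assembled from the tree's reduction to Timár's two
theorems in the quasi-transitive setting and their proofs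
(`Timar2006_noInfiniteLightClusters_quasiTransitive`, `Timar2006_finiteLevelUnion_quasiTransitive`).
[cite: Hutchcroft2016, Thm. 1.1 and §2] [cite: Timar2006, Thm. 4.3, Thm. 5.5] -/
theorem Hutchcroft2016_noPercolationAtCriticality_holds :
    Hutchcroft2016_noPercolationAtCriticality :=
  Hutchcroft2016_noPercolationAtCriticality_of_quasiTransitive_theorems
    (fun G _ hconn hqt hU o => Timar2006_noInfiniteLightClusters_quasiTransitive G hconn hqt hU o)
    (fun G _ hconn hqt hU o p hheavy =>
      Timar2006_finiteLevelUnion_quasiTransitive G hconn hqt hU o p hheavy)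

end Literature.Barriers.CriticalPhenomena

end
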